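import Mathlib
import HarnessLib
import Summits.AtomisticToContinuum.Crystallization.Theorems.PricedLinkCensusSoftFourRingsLocalC

/-!
# Soft four-rings: the bonded vertices of a slack triangle

Support file for `SoftFourRings` (route `PricedLinkCensus`, sub-problem `Crystallization`).

`fan_end_of_nonbt_facet`: at a three-fan vertex `a` with fan `x 0 – x 1 – x 2 – x 3`, a bond
`{a, x k}` lying in some facet with `nb ≠ 0` is an END bond (`k = 0` or `k = 3`): the middle bonds
already lie in two bond triangles.  `slack_ab_vertex`: consequently, if `a` has two distinct
partners `b`, `p` whose bonds lie in non-bond-triangle facets (for a slack triangle `{a, b, c}`: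
the slack triangle itself and the end triangle `{c, p, a}`), then `N(a) = {p, u, r, b}` with fan
`p – u – r – b` and chords `pr`, `ub`, `pb` outside `B`.
-/

namespace Summit.AtomisticToContinuum.Crystallization.Theorems

open Real RealInnerProductSpace Literature.Geometry.DiscreteGeometry

section Setting

variable {X : Finset (EuclideanSpace ℝ (Fin 3))} {B : Finset (Finset (EuclideanSpace ℝ (Fin 3)))}
  (hT : musinTarasov2012_tammes_thirteen) (hX1 : ∀ y ∈ X, ‖y‖ = 1) (hcard : X.card = 12)
  (hsepX : ∀ u ∈ X, ∀ u' ∈ X, u ≠ u' → ⟪u, u'⟫ ≤ 1 - 1 / (2 * (101 / 100 : ℝ) ^ 2))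
  (hB : ∀ T ∈ B, ∃ u ∈ X, ∃ u' ∈ X, u ≠ u' ∧ 1 - (101 / 100 : ℝ) ^ 2 / 2 ≤ ⟪u, u'⟫ ∧ T = {u, u'})
  (hBcard : B.card = 24)
  (hdeg : ∀ v ∈ X, ∃ w : Fin 4 → EuclideanSpace ℝ (Fin 3), (∀ k, w k ∈ X) ∧
    Function.Injective w ∧ (∀ k, w k ≠ v) ∧
    (∀ k, ({v, w k} : Finset (EuclideanSpace ℝ (Fin 3))) ∈ B) ∧
    ∀ y, ({v, y} : Finset (EuclideanSpace ℝ (Fin 3))) ∈ B → ∃ k, y = w k)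

include hT hX1 hcard hsepX hB hBcard in
open scoped Classical in
/-- **A fan bond lying in a facet with `nb ≠ 0` is an end bond.** -/
theorem fan_end_of_nonbt_facet {a : EuclideanSpace ℝ (Fin 3)}
    (x : Fin 4 → EuclideanSpace ℝ (Fin 3)) (hxinj : Function.Injective x) (hxa : ∀ k, x k ≠ a)
    (hax : ∀ k, ({a, x k} : Finset (EuclideanSpace ℝ (Fin 3))) ∈ B)
    (hB01 : ({x 0, x 1} : Finset (EuclideanSpace ℝ (Fin 3))) ∈ B)
    (hB12 : ({x 1, x 2} : Finset (EuclideanSpace ℝ (Fin 3))) ∈ B)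
    (hB23 : ({x 2, x 3} : Finset (EuclideanSpace ℝ (Fin 3))) ∈ B) (k : Fin 4)
    {f : EuclideanSpace ℝ (Fin 3)} (hfF : f ∈ facetNormals X)
    (hsub : ({a, x k} : Finset (EuclideanSpace ℝ (Fin 3))) ⊆ tightSet X f)
    (hnb : ((edgesOfFacet X f).filter (fun T => T ∉ B)).card ≠ 0) : k = 0 ∨ k = 3 := by
  have h0 : (0 : EuclideanSpace ℝ (Fin 3)) ∈ interior (convexHull ℝ (X : Set (EuclideanSpace ℝ (Fin 3)))) :=
    zero_mem_interior_convexHull_of_twelve_le_card hT hX1 hcard.ge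
      (ca := 1 - 1 / (2 * (101 / 100 : ℝ) ^ 2)) (by norm_num) hsepX
  obtain ⟨-, hBH, -, -, -, -, -, -⟩ := hull_counts_of_twelve hT hX1 hcard hsepX hB hBcard
  have hx01 : x 0 ≠ x 1 := fun h => by simpa using hxinj h
  have hx02 : x 0 ≠ x 2 := fun h => by simpa using hxinj h
  have hx12 : x 1 ≠ x 2 := fun h => by simpa using hxinj h
  have hx13 : x 1 ≠ x 3 := fun h => by simpa using hxinj h
  obtain ⟨d₀, ⟨hd₀F, -, -, hd₀nb⟩, hd₀T⟩ := exists_bt_at hX1 hsepX hB (hax 0) hB01 (hax 1)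
  obtain ⟨d₁, ⟨hd₁F, -, -, hd₁nb⟩, hd₁T⟩ := exists_bt_at hX1 hsepX hB (hax 1) hB12 (hax 2)
  obtain ⟨d₂, ⟨hd₂F, -, -, hd₂nb⟩, hd₂T⟩ := exists_bt_at hX1 hsepX hB (hax 2) hB23 (hax 3)
  have hfd : ∀ d, ((edgesOfFacet X d).filter (fun T => T ∉ B)).card = 0 → d ≠ f :=
    fun d hd he => hnb (he ▸ hd)
  fin_cases k
  · exact Or.inl rfl
  · exfalso
    refine false_of_three_facetsOfEdge hX1 h0 (hBH (hax 1)) hd₀F hd₁F hfF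
      (by rw [hd₀T]; exact pair_subset_three_right _ _ _)
      (by rw [hd₁T]; exact pair_subset_three_left _ _ _) hsub ?_ (hfd d₀ hd₀nb) (hfd d₁ hd₁nb)
    intro he
    have : x 0 ∈ tightSet X d₁ := by rw [← he, hd₀T]; simp
    rw [hd₁T] at this
    exact not_mem_three (hxa 0) hx01 hx02 this
  · exfalso
    refine false_of_three_facetsOfEdge hX1 h0 (hBH (hax 2)) hd₁F hd₂F hfF
      (by rw [hd₁T]; exact pair_subset_three_right _ _ _)
      (by rw [hd₂T]; exact pair_subset_three_left _ _ _) hsub ?_ (hfd d₁ hd₁nb) (hfd d₂ hd₂nb)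
    intro he
    have : x 1 ∈ tightSet X d₂ := by rw [← he, hd₁T]; simp
    rw [hd₂T] at this
    exact not_mem_three (hxa 1) hx12 hx13 this
  · exact Or.inr rfl

include hT hX1 hcard hsepX hB hBcard hdeg in
open scoped Classical in
/-- **The bonded vertices of a slack triangle.**  If `t_a = 3` and `a` has distinct partners
`b`, `p` whose bonds `{a, b}`, `{a, p}` lie in facets with `nb ≠ 0`, then
`N(a) = {p, u, r, b}` with the fan `p – u – r – b`. -/
theorem slack_ab_vertex {a b p : EuclideanSpace ℝ (Fin 3)} (ha : a ∈ X)
    (hta : ((facetNormals X).filter (fun c' => a ∈ tightSet X c' ∧ (tightSet X c').card = 3 ∧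
      ((edgesOfFacet X c').filter (fun T => T ∉ B)).card = 0)).card = 3)
    (hab : ({a, b} : Finset (EuclideanSpace ℝ (Fin 3))) ∈ B)
    (hap : ({a, p} : Finset (EuclideanSpace ℝ (Fin 3))) ∈ B) (hbp : b ≠ p)
    (hfb : ∃ f ∈ facetNormals X, ({a, b} : Finset (EuclideanSpace ℝ (Fin 3))) ⊆ tightSet X f ∧
      ((edgesOfFacet X f).filter (fun T => T ∉ B)).card ≠ 0)
    (hfp : ∃ g ∈ facetNormals X, ({a, p} : Finset (EuclideanSpace ℝ (Fin 3))) ⊆ tightSet X g ∧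
      ((edgesOfFacet X g).filter (fun T => T ∉ B)).card ≠ 0) :
    ∃ u r : EuclideanSpace ℝ (Fin 3), u ∈ X ∧ r ∈ X ∧
      (∀ y, ({a, y} : Finset (EuclideanSpace ℝ (Fin 3))) ∈ B ↔ (y = p ∨ y = u ∨ y = r ∨ y = b)) ∧
      p ≠ u ∧ p ≠ r ∧ p ≠ b ∧ u ≠ r ∧ u ≠ b ∧ r ≠ b ∧ u ≠ a ∧ r ≠ a ∧
      ({p, u} : Finset (EuclideanSpace ℝ (Fin 3))) ∈ B ∧
      ({u, r} : Finset (EuclideanSpace ℝ (Fin 3))) ∈ B ∧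
      ({r, b} : Finset (EuclideanSpace ℝ (Fin 3))) ∈ B ∧
      ({p, r} : Finset (EuclideanSpace ℝ (Fin 3))) ∉ B ∧
      ({u, b} : Finset (EuclideanSpace ℝ (Fin 3))) ∉ B ∧
      ({p, b} : Finset (EuclideanSpace ℝ (Fin 3))) ∉ B := by
  have h0 : (0 : EuclideanSpace ℝ (Fin 3)) ∈ interior (convexHull ℝ (X : Set (EuclideanSpace ℝ (Fin 3)))) :=
    zero_mem_interior_convexHull_of_twelve_le_card hT hX1 hcard.ge
      (ca := 1 - 1 / (2 * (101 / 100 : ℝ) ^ 2)) (by norm_num) hsepX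
  obtain ⟨x₀, hxX₀, hxinj₀, hxa₀, hax₀, honly₀⟩ := hdeg a ha
  obtain ⟨x, hxX, hxinj, hxa, hax, honly, hB01, hB12, hB23, hB02, hB13, hB03⟩ :=
    exists_path_family_of_three hX1 h0 hsepX hB ha x₀ hxX₀ hxinj₀ hxa₀ hax₀ honly₀ hta
  have hx01 : x 0 ≠ x 1 := fun h => by simpa using hxinj h
  have hx02 : x 0 ≠ x 2 := fun h => by simpa using hxinj h
  have hx03 : x 0 ≠ x 3 := fun h => by simpa using hxinj h
  have hx12 : x 1 ≠ x 2 := fun h => by simpa using hxinj h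
  have hx13 : x 1 ≠ x 3 := fun h => by simpa using hxinj h
  have hx23 : x 2 ≠ x 3 := fun h => by simpa using hxinj h
  obtain ⟨kb, hkb⟩ := honly b hab
  obtain ⟨kp, hkp⟩ := honly p hap
  obtain ⟨f, hfF, hfsub, hfnb⟩ := hfb
  obtain ⟨g, hgF, hgsub, hgnb⟩ := hfp
  have hkb03 := fan_end_of_nonbt_facet hT hX1 hcard hsepX hB hBcard x hxinj hxa hax hB01 hB12
    hB23 kb hfF (by rw [← hkb]; exact hfsub) hfnb
  have hkp03 := fan_end_of_nonbt_facet hT hX1 hcard hsepX hB hBcard x hxinj hxa hax hB01 hB12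
    hB23 kp hgF (by rw [← hkp]; exact hgsub) hgnb
  have hiff : ∀ y, ({a, y} : Finset (EuclideanSpace ℝ (Fin 3))) ∈ B ↔
      (y = x 0 ∨ y = x 1 ∨ y = x 2 ∨ y = x 3) := by
    intro y
    constructor
    · intro hy
      obtain ⟨k, rfl⟩ := honly y hy
      fin_cases k <;> simp
    · rintro (rfl | rfl | rfl | rfl) <;> exact hax _
  rcases hkb03 with rfl | rfl <;> rcases hkp03 with rfl | rfl
  · exact absurd (hkb.trans hkp.symm) hbp
  · -- `b = x 0`, `p = x 3`: the fan read backwards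
    subst hkb; subst hkp
    refine ⟨x 2, x 1, hxX 2, hxX 1, fun y => ?_, hx23.symm, hx13.symm, hx03.symm, hx12.symm, hx02.symm,
      hx01.symm, hxa 2, hxa 1, by rw [Finset.pair_comm]; exact hB23,
      by rw [Finset.pair_comm]; exact hB12, by rw [Finset.pair_comm]; exact hB01,
      by rw [Finset.pair_comm]; exact hB13, by rw [Finset.pair_comm]; exact hB02,
      by rw [Finset.pair_comm]; exact hB03⟩
    rw [hiff]
    constructor <;> rintro (rfl | rfl | rfl | rfl) <;> simp only [true_or, or_true]
  · -- `b = x 3`, `p = x 0`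
    subst hkb; subst hkp
    refine ⟨x 1, x 2, hxX 1, hxX 2, fun y => ?_, hx01, hx02, hx03, hx12, hx13, hx23, hxa 1, hxa 2,
      hB01, hB12, hB23, hB02, hB13, hB03⟩
    rw [hiff]
  · exact absurd (hkb.trans hkp.symm) hbp

end Setting

end Summit.AtomisticToContinuum.Crystallization.Theorems
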